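import Literature.Computability.AlgebraicComplexity.LaurentPolyOrder
import Literature.Computability.AlgebraicComplexity.CircuitDepth
import Literature.Computability.AlgebraicComplexity.StandardFamilies
import HarnessLib

/-!
# Andrews–Forbes 2022 §2.2–§2.3, §6.1–§6.2, §7, §8 — the matrix generator `𝒢_{n,m,r}`, low-rank
# matrices hit the closure of low-depth circuits and (conditionally) of formulas, and the IPS
# instance `{det X = 0, XY = I}` (val-lit t24, row AndrewsForbes2022-B; source
# `paper:arxiv-2112.00792`; bib `AndrewsForbes2022`)

Typed literature (D-0014/D-0064 statement file), companion of
`AndrewsForbes2022DeterminantalIdeals.lean` (§3–§5). Source: R. Andrews, M. A. Forbes, *Ideals,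
determinants, and straightening*, STOC 2022 = arXiv:2112.00792 [`AndrewsForbes2022`]. Locators
`pNNNN.txt:Lnn` are chunk files of `lit read paper:arxiv-2112.00792`.

## Content (what is typed, and how)

* §2.2 Def. 2.5 (hitting set generator for a set `𝒞` of polynomials): `IsHittingSetGenFor 𝒞 G` —
  "for every nonzero `f ∈ 𝒞`, `f(𝒢(y)) ≠ 0`". (The tree's FSV-frame
  `Literature.Barriers.ValiantsHypothesis.IsHittingSetGenerator` is the same sentence but typed
  over a monomial set `M ⊆ (σ →₀ ℕ)` as output index — the coefficient-space frame; here the outputs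
  are matrix entries, so the plain form is spelled out.) §2.1 (p0011:L44) "`𝒞̄` = the set of
  polynomials computed by the border of this same set of circuits": `borderClass F 𝒞` for a class
  `𝒞` of polynomials over `F((ε))` (`PolyOrdGE 1 (h - f)`, tree `LaurentPolyOrder.lean`); the
  classes "size-`s` product-depth-`Δ` circuits" and "size-`s` formulas" over a coefficient ring are
  `productDepthEdgeClass` (size = WIRES, the tree's `ArithCircuit.edgeSize`) and `formulaClass`
  (fan-in-two formulas, size = GATES, the tree's `formulaComplexity`) of `CircuitDepth.lean`, over
  `F((ε))` for border computation (Def. 2.1: circuits "defined over `F((ε))`");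
  `borderFormulaComplexity` = least `s` with `f` in the closure of size-`s` formulas.  See
  "Errata / conventions" below for the size measures.
* §2.3 Construction 2.8 `𝒢_{n,m,r}(Y,Z) = YZ` (`matrixGenerator`), Lemma 2.9 (2) (degree `2`,
  proved), **Lemma 2.10** (`f(𝒢_{n,m,r-1}) = 0 ↔ f ∈ I^det_{n,m,r}`, any field — named fact).
* §6.1 **Corollary 6.5** (cf. [LST21]: border product-depth-`Δ` lower bound for `IMM_{n,d}`),
  §6.2 **Lemma 6.6** (every nonzero `f ∈ I^det_{n,m,r}` needs product-depth-`Δ` border size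
  `r^{(log r)^{exp(-O(Δ))}}`), **Lemma 6.7** (`𝒢_{√n,√n,r-1}` with
  `r = 2^{(log s)^{1 - exp(-O(Δ))}}` hits the closure of size-`s` product-depth-`Δ` circuits) —
  named facts, with the `O(·)` constants existential and the asymptotic thresholds ("When `r` is
  sufficiently large", p0033:L77) made EXPLICIT as `∃ r₀ / s₀ / n₀` (a documented weakening of the
  printed form, which carries only the universal constant); unspecified `log` read as the natural
  logarithm where it sits in a lower bound (the weaker reading) and as `log₂` inside `2^{(log s)^…}`.
* §7 **Lemma 7.1** (arbitrary field: if border formula complexity of `(K_σ | K_σ)` is `≥ t(σ₁)`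
  for a monotone `t`, then `𝒢_{√n,√n,r-1}` hits the closure of `n`-variate size-`s` formulas once
  `t(r) ≥ 2sn`) — named fact over the tree's `kBideterminant`.
* §2.8 Def. 2.40 (IPS certificate, `IsIPSCertificate`), §8 **Lemma 8.1** (⊇ Lemma 2.41 [FSTW16]:
  `1 - C(x, 0, g(x))` is a nonzero element of `⟨f_1, …, f_m⟩` — named fact) and
  **Proposition 8.7** (the explicit depth-three `det_n`-oracle refutation
  `C = 1 - det_n(Z + I_n) + w · det_n(Y)` of `{det_n(X) = 0, XY - I_n = 0}` — PROVED:
  `AndrewsForbes2022_prop_8_7`).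

## NOT typed here (recorded for the GAP ledger)

* **Theorem 6.8** (the recursive generators `𝒢_k` for product depth `Δ ≤ o(log log log n)`, with
  seed length `n^{1/2^k} s^{o(1)}`, degree `2^k`, "explicit"): a family of statements whose every
  parameter is an unnamed `o(1)`/`ω(1)`; its typable mathematical core is the one-step generator,
  Lemma 6.7 (typed), iterated `k` times (proof p0034:L47–p0035).  It IS typed, and PROVED, in the
  companion file `AndrewsForbes2022Thm68Proofs.lean` (val-lit t24, 2026-08-27):
  `AndrewsForbes2022_thm_6_8_explicit` (every field; the recursion `Proposition72.iterGen` with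
  explicit per-step thresholds `Theorem68.IterHyp` from Lemma 6.7's constant and thresholds,
  including Lemma 6.7's characteristic condition — which is the content of Remark 6.9's last
  sentence — seed length, degree `≤ 2^k`, per-coordinate and multi-output wire bounds with
  product-depth `≤ k`) and `AndrewsForbes2022_thm_6_8_asymptotic` (bullets (1)–(3) in the printed
  `o(1)` form for `char F = 0` and each FIXED `Δ`; bullet (4) and the body of Remark 6.9 not
  formalized), on the composition calculus for `productDepthEdgeClass` of
  `ArithCircuitComposition.lean` (`ArithCircuit.compose`: wires add, product-depths add).
  **Proposition 7.2 and Theorem 7.3** (the formula analogues) ARE typed, and PROVED, in the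
  companion files `AndrewsForbes2022Prop72Proofs.lean` (`AndrewsForbes2022_prop_7_2_explicit`:
  the recursion with explicit thresholds; `AndrewsForbes2022_prop_7_2_asymptotic`: bullets (1)–(3)
  in the printed `o(1)` form under `t(r) ≥ r^{ω(1)}`, plain-formula reading, bullet (4) not
  formalized) and `AndrewsForbes2022Thm73Proofs.lean` (`AndrewsForbes2022_thm_7_3_explicit`: the
  reduction "border-formula hardness of `det` ⇒ of every `(K_σ | K_σ)`" with explicit constants,
  `AndrewsForbes2022_thm_7_3_lemma71Hypothesis` / `_generator`, and the VBP-completeness step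
  `borderFormulaComplexity_le_of_layeredABPComputes`), val-lit t24, 2026-08-26.
* §8 Lemma 8.2, Theorem 8.3, Corollary 8.4, Theorem 8.6 (IPS lower bounds for the rank-condenser
  system `{det_r(E X Eᵀ) = 0}_E ∪ {XY = I_n, X ∘ X = X, Y ∘ Y = Y}`) and §2.3 Def. 2.11 / Lemma 2.12
  (weak lossless rank condensers [FS12, FG15]): proof-complexity applications outside the V4 use of
  this source.  They ARE typed, and PROVED, in the companion files
  `AndrewsForbes2022RankCondenser.lean` (Def. 2.11 `IsWeakLosslessRankCondenser`; Lemma 2.12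
  `AndrewsForbes2022_lemma_2_12`, proved; Lemma 8.2 typed AS PRINTED as `AndrewsForbes2022_lemma_8_2`
  and REFUTED, `not_AndrewsForbes2022_lemma_8_2` — ERRATUM: for `r = 1`, `n = 2` and `M` alternating
  of rank `2`, `E M Eᵀ = 0` for every row vector `E` (the printed proof's rank step fails when
  `rank M > r`); its true direction `_lemma_8_2_mp` and the two-sided repair `_lemma_8_2_twoSided`
  are proved) and `AndrewsForbes2022IPSLowerBounds.lean` (`AndrewsForbes2022_thm_8_3`, `_cor_8_4`,
  `_thm_8_6`: proved for every finite family `𝓔` from Lemma 8.1, Cauchy–Binet, Thm. 3.8 and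
  Lemma 6.6 — the theorems quantify over refutations and do not depend on Lemma 8.2),
  val-lit t24, 2026-08-27. Remarks 8.5, 8.8: prose.
* Lemma 2.9 (3), circuit clause (a multi-output circuit of size `2nmr` and product-depth `1`):
  per coordinate (`≤ 3r` wires, product-depth `1`) it is
  `matrixGenerator_mem_productDepthEdgeClass` of `AndrewsForbes2022Thm68Proofs.lean`.
  Lemma 2.9 (1) (the image of `𝒢_{n,m,r}` is the set of matrices
  of rank `≤ r`) and **Lemma 2.6** (seed length vs degree, `binom(ℓ+d, d) ≥ n`) are typed and PROVED
  in `AndrewsForbes2022SeedLength.lean` (`exists_eval_matrixGenerator_eq_of_rank_le`,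
  `AndrewsForbes2022_lemma_2_6`); Lemma 2.9 (3), formula clause, is
  `formulaComplexity_matrixGenerator_le` (`AndrewsForbes2022Prop72Proofs.lean`); the homogeneous
  half of Lemma 7.1 stays untyped (no homogeneous-formula size in the tree).
* Lemmas 6.1–6.4 ("cf. [LST21a]": [LST21a]'s two steps re-run "`+ O(ε)`") are not typed as separate
  statements: in the tree they are ONE run of the proved [LST21a] engine over the field `F((ε))`
  inside the proof of Cor. 6.5, `AndrewsForbes2022BorderLST.lean` (`AndrewsForbes2022_cor_6_5_holds`;
  Lemma 6.2's step "the lower bound on relative rank extends to `P_w + O(ε)`" is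
  `BorderLST.relRank_le_of_polyOrdGE` there).

## Errata / conventions (revision of 2026-08-26, after the val-lit referee stamp and rulings)

* **§6 size = wires.** "Circuit of size `s` and product-depth `Δ`" is typed over
  `productDepthEdgeClass` with `ArithCircuit.edgeSize` (sum of fan-ins; [LST21a]'s measure as
  recorded in `CircuitDepth.lean`), under which the printed proof steps (`size ≥ #variables`,
  `deg ≤ s^Δ`) hold verbatim in the tree's list-presented model and a printed node-count bound `B`
  transfers as `2 · edgeSize + 1 ≥ B`, absorbed by the existential constants.  The first landing
  typed §6 against the gates-only `productDepthCircuitSize` (a bare variable costs `0`), which made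
  the typed bounds stronger than print; `productDepthClass` survives only as the gate-count variant,
  used by no statement.
* **§6 thresholds after `Δ`.** Cor. 6.5 is asymptotic in `n` AND `d` ([LST21a] "growing
  parameters"): typed as `∀ Δ ≥ 1, ∃ δ > 0, ∃ d₀, ∀ n, ∀ d₀ ≤ d ≤ (log n)/100, n^{d^δ} ≤ s` (the
  first rendering, with only `1 ≤ d`, was FALSE at `d = 1`: `IMM_{n,1} = x_{1,1}`); Lemmas 6.6/6.7
  keep print's universal `c` in `exp(-cΔ)` but take their thresholds `r₀`, `s₀` after `Δ`.
* **§7 formula size = fan-in-two gate count** (`formulaComplexity`), print counts leaves; Lemma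
  7.1's printed `t(r) ≥ 2sn` becomes `t(r) > 2(s+1)n` by the leaf-to-gate translation spelled out
  in its docstring (the first rendering was false at `s = 0`).

Honest framing: typed literature for the val-lit NP corpus (V4: low-rank matrices as hitting sets
= "no small low-depth equations for bounded-rank matrices"); VP ≠ VNP is NOT proved and nothing here
is progress on it.

## References

* [AndrewsForbes2022] R. Andrews, M. A. Forbes, STOC 2022, doi:10.1145/3519935.3520025,
  arXiv:2112.00792 — Def. 2.1, Defs. 2.4–2.5, Construction 2.8, Lemmas 2.9–2.10, Def. 2.40,
  Lemma 2.41, Lemmas 6.1–6.4, Cor. 6.5, Lemmas 6.6–6.7, Thm. 6.8, Rem. 6.9, Lemma 7.1, Prop. 7.2,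
  Thm. 7.3, Lemmas 8.1–8.2, Thm. 8.3, Cor. 8.4, Thm. 8.6, Prop. 8.7, Rem. 8.8.
* [LimayeSrinivasanTavenas2021] N. Limaye, S. Srinivasan, S. Tavenas, FOCS 2021 (behind Cor. 6.5).
* [GrochowPitassi2018] J. A. Grochow, T. Pitassi, J. ACM 65 (2018) (Def. 2.40, the IPS).
-/

noncomputable section

open MvPolynomial Matrix
open scoped RatFunc

namespace Literature.Computability.AlgebraicComplexity

universe u v w

/-! ### §2.2 (Def. 2.5) and §2.1: hitting set generators, closures of circuit classes -/

section Classes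

variable (F : Type u) [Field F]

/-- **Def. 2.5** (p0012:L53): a polynomial map `𝒢 : F^ℓ → F^M` (coordinates `G m ∈ F[y_τ]`) is a
hitting set generator for a set `𝒞 ⊆ F[x_M]` of polynomials if `f(𝒢(y)) ≠ 0` for every nonzero
`f ∈ 𝒞`; `f(𝒢(y))` is `bind₁ G f`. Same sentence as the tree's FSV-frame
`Literature.Barriers.ValiantsHypothesis.IsHittingSetGenerator` (there the output index is a monomial
set `M ⊆ (σ →₀ ℕ)`); here `M` is any index type (matrix entries). [cite: AndrewsForbes2022, Def. 2.5] -/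
def IsHittingSetGenFor {M : Type v} {τ : Type w} (𝒞 : Set (MvPolynomial M F))
    (G : M → MvPolynomial τ F) : Prop :=
  ∀ f ∈ 𝒞, f ≠ 0 → MvPolynomial.bind₁ G f ≠ 0

/-- **The closure `𝒞̄` of a circuit class** (§2.1, p0011:L44: "if `𝒞 ⊆ F[x]` is a set of polynomials
computed by some class of circuits, we denote by `𝒞̄ ⊆ F[x]` the set of polynomials computed by the
border of this same set of circuits"; Def. 2.1: a circuit over `F((ε))` border computes `f` if it
computes `f + O(ε)`): for the set `𝒞` of polynomials over `F((ε))` computed by the class, the set of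
`f ∈ F[x]` with `h - f = O(ε)` coefficientwise (`PolyOrdGE 1`) for some `h ∈ 𝒞`.
[cite: AndrewsForbes2022, Def. 2.1 and §2.1 (closure of a class)] -/
def borderClass {M : Type v} (𝒞 : Set (MvPolynomial M (LaurentSeries F))) : Set (MvPolynomial M F) :=
  {f | ∃ h ∈ 𝒞, PolyOrdGE 1 (h - MvPolynomial.map (algebraMap F (LaurentSeries F)) f)}

/-- The class of polynomials computed by (unbounded fan-in) circuits of **wire size `≤ s` and
product-depth `≤ Δ`** over the coefficient semiring `k` — THE §6 CLASS OF RECORD ("circuit of size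
`s` and product-depth `Δ`", p0033:L11; Lemma 6.4, Cor. 6.5, Lemmas 6.6–6.7).  SIZE CONVENTION: the
size of a circuit is its number of WIRES, the tree's `ArithCircuit.edgeSize` (sum of the fan-ins of
all gates, `CircuitDepth.lean`: "the size measure of LST 2021, §2"; the tree's precedent for
unbounded-fan-in constant-depth statements, `DepthThreeChasm.lean`), in the tree's list-presented
model (`ArithCircuit`: weighted-sum and product gates of unbounded fan-in, scalars on wires free as
in print, p0011:L69).  Under this measure the two steps of the printed §6 proofs hold verbatim in
the model — a variable `f` depends on is an operand occurrence, so `edgeSize ≥ #vars(f)` (proof of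
Lemma 6.6, p0033:L46–47), and every product gate has fan-in `≤ edgeSize`, so a product-depth-`Δ`
circuit of size `s` computes a polynomial of degree `≤ s^Δ` (proof of Lemma 6.7, p0034:L6, behind
the hypothesis `char F > s^Δ`) — and a printed node-count ("number of nodes of the DAG", [LST21a])
lower bound `B` transfers to `2 · edgeSize + 1 ≥ B` (prune unused gates, one unary copy node per
repeated operand), a constant factor absorbed by the existential constants / thresholds of the typed
statements, which are chosen AFTER `Δ`.  NOT the tree's gates-only `ArithCircuit.size` /
`productDepthCircuitSize` (a bare variable has gate-size `0`, `x^m` is one gate): against that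
measure the printed lower bounds would be over-stated (the first landing of this file used it; val-lit
referee stamp and ruling of 2026-08-26, see the module docstring "Errata / conventions").
[cite: AndrewsForbes2022, §6.1 (Lemma 6.4, Cor. 6.5; size conventions of [LST21a])] -/
def productDepthEdgeClass (k : Type u) [CommSemiring k] (M : Type v) (s Δ : ℕ) :
    Set (MvPolynomial M k) :=
  {h | ∃ P : ArithCircuit k M, P.Computes h ∧ P.productDepth ≤ Δ ∧ P.edgeSize ≤ s}

/-- `productDepthEdgeClass` is monotone in the size bound. [cite: AndrewsForbes2022, §6.1 (Cor. 6.5)] -/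
theorem productDepthEdgeClass_mono (k : Type u) [CommSemiring k] (M : Type v) {s s' : ℕ}
    (h : s ≤ s') (Δ : ℕ) : productDepthEdgeClass k M s Δ ⊆ productDepthEdgeClass k M s' Δ := by
  rintro f ⟨P, hc, hΔ, hs⟩
  exact ⟨P, hc, hΔ, hs.trans h⟩

/-- GATE-COUNT VARIANT, NOT the §6 class of record: the polynomials with a circuit of product-depth
`≤ Δ` and at most `s` GATES (the tree's measure `productDepthCircuitSize`; a bare variable costs
`0`).  Kept as vocabulary only; no statement of this file is typed against it (see
`productDepthEdgeClass`). [cite: AndrewsForbes2022, §6.1 (circuit classes; gate-count variant)] -/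
def productDepthClass (k : Type u) [CommSemiring k] (M : Type v) (s Δ : ℕ) : Set (MvPolynomial M k) :=
  {h | productDepthCircuitSize Δ h ≤ s}

/-- The class of polynomials computed by **fan-in-two formulas with at most `s` gates** over `k`
(the tree's `formulaComplexity`: least number of gates of a fan-in-two formula), the rendering of
§7's "`n`-variate formulas of size `s`" (p0036:L20).  SIZE CONVENTION: print's formula size counts
LEAVES (a formula has size `≥ 1`; "a formula of size `sn`" after substituting `n`-variate linear
forms into the leaves, p0036:L31, is a leaf count); the tree counts fan-in-two GATES (a variable
costs `0`; a `g`-gate fan-in-two formula has `≤ g + 1` leaves).  Statements over this class carry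
the leaf-to-gate translation of their constants explicitly (Lemma 7.1 below).
[cite: AndrewsForbes2022, §7 (Lemma 7.1)] -/
def formulaClass (k : Type u) [CommSemiring k] (M : Type v) (s : ℕ) : Set (MvPolynomial M k) :=
  {h | formulaComplexity h ≤ s}

/-- **Border formula complexity** of `f ∈ F[x]` (§2.1, p0011:L66: "one can also consider border
complexity with respect to subclasses of algebraic circuits, such as formulas"): the least `s` such
that some fan-in-two formula with `≤ s` gates over `F((ε))` computes `f + O(ε)` (gate-count measure
of `formulaClass`; print counts leaves). [cite: AndrewsForbes2022, §2.1 (border complexity for formulas)] -/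
def borderFormulaComplexity {M : Type v} (f : MvPolynomial M F) : ℕ :=
  sInf {s | f ∈ borderClass F (formulaClass (LaurentSeries F) M s)}

variable {F}

/-- Exact membership gives border membership (`h = f`, error term `0`). [cite: AndrewsForbes2022, Def. 2.1] -/
theorem mem_borderClass_of_mem {M : Type v} {𝒞 : Set (MvPolynomial M (LaurentSeries F))}
    {f : MvPolynomial M F} (hf : MvPolynomial.map (algebraMap F (LaurentSeries F)) f ∈ 𝒞) :
    f ∈ borderClass F 𝒞 :=
  ⟨_, hf, by rw [sub_self]; exact PolyOrdGE.zero 1⟩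

/-- Closures are monotone in the class. [cite: AndrewsForbes2022, §2.1 (closure of a class)] -/
theorem borderClass_mono {M : Type v} {𝒞 𝒞' : Set (MvPolynomial M (LaurentSeries F))} (h : 𝒞 ⊆ 𝒞') :
    borderClass F 𝒞 ⊆ borderClass F 𝒞' := by
  rintro f ⟨g, hg, hfg⟩
  exact ⟨g, h hg, hfg⟩

/-- A generator hitting a class hits every subclass. [cite: AndrewsForbes2022, Def. 2.5] -/
theorem IsHittingSetGenFor.mono {M : Type v} {τ : Type w} {𝒞 𝒞' : Set (MvPolynomial M F)}
    {G : M → MvPolynomial τ F} (hG : IsHittingSetGenFor F 𝒞' G) (h : 𝒞 ⊆ 𝒞') :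
    IsHittingSetGenFor F 𝒞 G :=
  fun f hf hf0 => hG f (h hf) hf0

end Classes

/-! ### §2.3: Construction 2.8 (`𝒢_{n,m,r}(Y,Z) = YZ`), Lemma 2.9, Lemma 2.10 -/

section MatrixGenerator

/-- Seed variables of `𝒢_{n,m,r}`: the entries of `Y ∈ F^{n × r}` (left summand) and of
`Z ∈ F^{r × m}` (right summand), `nr + rm` in all. [cite: AndrewsForbes2022, Construction 2.8] -/
abbrev MatGenSeed (n m r : ℕ) : Type := (Fin n × Fin r) ⊕ (Fin r × Fin m)

variable (F : Type u) [Field F]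

/-- **Construction 2.8** (p0013:L35): `𝒢_{n,m,r} : F^{n×r} × F^{r×m} → F^{n×m}`,
`𝒢_{n,m,r}(Y,Z)_{i,j} = (YZ)_{i,j} = Σ_k y_{i,k} z_{k,j}`, as a polynomial map (one polynomial per
entry `(i,j)`). [cite: AndrewsForbes2022, Construction 2.8] -/
def matrixGenerator (n m r : ℕ) : Fin n × Fin m → MvPolynomial (MatGenSeed n m r) F :=
  fun ij => ∑ k : Fin r, X (Sum.inl (ij.1, k)) * X (Sum.inr (k, ij.2))

variable {F}

/-- **Lemma 2.9 (2)**, degree part: each coordinate of `𝒢_{n,m,r}` is a polynomial of degree `≤ 2`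
(it is the `2r`-sparse quadratic `Σ_k y_{i,k} z_{k,j}`). [cite: AndrewsForbes2022, Lemma 2.9] -/
theorem totalDegree_matrixGenerator_le (n m r : ℕ) (ij : Fin n × Fin m) :
    (matrixGenerator F n m r ij).totalDegree ≤ 2 := by
  unfold matrixGenerator
  refine totalDegree_finsetSum_le fun k _ => ?_
  refine (totalDegree_mul _ _).trans ?_
  rw [totalDegree_X, totalDegree_X]

/-- For `r = 0` the generator is the zero map (`Y`, `Z` are empty). [cite: AndrewsForbes2022, Construction 2.8] -/
@[simp] theorem matrixGenerator_zero (n m : ℕ) (ij : Fin n × Fin m) :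
    matrixGenerator F n m 0 ij = 0 := by
  simp [matrixGenerator]

/-- **Andrews–Forbes 2022, Lemma 2.10** (p0013:L71): for ANY field `F` and `r ≤ min(n,m)`
(`r ≥ 1`), `f(𝒢_{n,m,r-1}(Y,Z)) = 0` if and only if `f ∈ I^det_{n,m,r}` (the ideal of the `r × r`
minors, tree `detIdeal`). Over algebraically closed `F` this is "`I^det_{n,m,r}` is the radical ideal
of the matrices of rank `< r`" ([BV88] via the Nullstellensatz, p0013:L60); the general case by
passage to `F̄`. [cite: AndrewsForbes2022, Lemma 2.10] -/
def AndrewsForbes2022_lemma_2_10 : Prop :=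
  ∀ (F : Type) [Field F] (n m r : ℕ), 1 ≤ r → r ≤ min n m →
  ∀ f : MvPolynomial (Fin n × Fin m) F,
    MvPolynomial.bind₁ (matrixGenerator F n m (r - 1)) f = 0 ↔ f ∈ detIdeal F n m r

end MatrixGenerator

/-! ### §6: Corollary 6.5, Lemma 6.6, Lemma 6.7 -/

section LowDepth

/-- **Andrews–Forbes 2022, Corollary 6.5** (cf. [LST21a]; p0033:L19): let `d ≤ (log n)/100` and
`char F = 0` or `char F > d`; any circuit of product-depth `Δ` computing `IMM_{n,d}(x) + O(ε)` has
size at least `n^{d^{exp(-O(Δ))}}`. Rendering: `IMM_{n,d}` = the `(1,1)` entry of a product of `d`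
generic `n × n` matrices (LST21; tree `immMatrix (Fin n) d F 0 0`); "computes `IMM + O(ε)` in size
`s`, product-depth `Δ`" = membership in `borderClass F (productDepthEdgeClass F((ε)) _ s Δ)` (size =
wires, see `productDepthEdgeClass`).  QUANTIFIER SHAPE (the border version of the tree's
`lst_productDepthCircuitSize_lower_bound` shape for [LST21a]): for every field and every product-depth
`Δ ≥ 1` there are an exponent `δ > 0` and a threshold `d₀` such that for all `n` and all
`d₀ ≤ d ≤ (log n)/100` (natural logarithm, the weaker reading of an unspecified base; this forces
`n ≥ e^{100 d₀}`) the bound `n^{d^δ} ≤ s` holds.  Disclosed weaker readings: print's exponent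
`d^{exp(-O(Δ))}` with a universal `O(·)` constant is rendered as `d^δ` with `δ = δ(F, Δ)`; the
statement is asymptotic in `d` as well as `n` ([LST21a]: "growing parameters"; for `d = 1`,
`IMM_{n,1} = x_{1,1}` is a single variable, so the printed sentence is not meant literally for small
`d`), whence the threshold `d₀`, chosen after `Δ`.  (Correction of 2026-08-26 after the val-lit
referee stamp and ruling: the first rendering had a `Δ`-uniform constant, only `1 ≤ d`, and the
gates-only size, and was false at `d = 1`.) [cite: AndrewsForbes2022, Cor. 6.5] -/
def AndrewsForbes2022_cor_6_5 : Prop :=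
  ∀ (F : Type) [Field F] (Δ : ℕ), 1 ≤ Δ → ∃ δ : ℝ, 0 < δ ∧ ∃ d₀ : ℕ, ∀ (n d : ℕ) [NeZero n],
    d₀ ≤ d → (d : ℝ) ≤ Real.log n / 100 → (ringChar F = 0 ∨ d < ringChar F) →
  ∀ s : ℕ, immMatrix (Fin n) d F 0 0 ∈ borderClass F (productDepthEdgeClass (LaurentSeries F) _ s Δ) →
    (n : ℝ) ^ ((d : ℝ) ^ δ) ≤ s

/-- **Andrews–Forbes 2022, Lemma 6.6** (p0033:L33): there is a universal constant `c > 0` such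
that for every nonzero `f ∈ I^det_{n,m,r}` with `char F = 0` or `char F > deg f`, any circuit of
product-depth `Δ` computing `f(X) + O(ε)` has size at least `r^{(log r)^{exp(-cΔ)}}`. Rendering:
size = wires (`productDepthEdgeClass`; the printed step "`f` depends on at least `max(n,m)`
variables ⇒ `s ≥ max(n,m)`", p0033:L46–47, holds for it); the universal `c` as printed; the proof
is asymptotic ("When `r` is sufficiently large", p0033:L77 — its absorption `n²m² ≤ O(s⁴)` divides
the exponent by a constant), so a threshold `r ≥ r₀` is made explicit and, since a `Δ`-uniform
threshold is not supported by the printed proof, `r₀` is chosen AFTER `Δ` (`Δ ≥ 1`); `log` read as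
the natural logarithm (the weaker reading of an unspecified base).  (Correction of 2026-08-26: the
first rendering had a `Δ`-uniform `r₀` and the gates-only size.) [cite: AndrewsForbes2022, Lemma 6.6] -/
def AndrewsForbes2022_lemma_6_6 : Prop :=
  ∃ c : ℝ, 0 < c ∧ ∀ Δ : ℕ, 1 ≤ Δ → ∃ r₀ : ℕ, ∀ (F : Type) [Field F] (n m r : ℕ), r₀ ≤ r →
  ∀ f : MvPolynomial (Fin n × Fin m) F, f ∈ detIdeal F n m r → f ≠ 0 →
    (ringChar F = 0 ∨ f.totalDegree < ringChar F) →
  ∀ s : ℕ, f ∈ borderClass F (productDepthEdgeClass (LaurentSeries F) _ s Δ) →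
    (r : ℝ) ^ ((Real.log r) ^ Real.exp (-(c * Δ))) ≤ s

/-- **Andrews–Forbes 2022, Lemma 6.7** (p0033:L92): let `char F = 0` or `char F > s^Δ`; there is a
universal `c > 0` such that for `r = 2^{(log s)^{1 - exp(-cΔ)}}` the map `𝒢_{√n,√n,r-1}(Y,Z)` is a
hitting set generator for the closure of `n`-variate circuits of size `s` and product-depth `Δ` —
low-rank matrices hit the closure of small low-depth circuits (the degree-`2` generator with seed
length `n^{1/2 + o(1)}`; Thm. 6.8 iterates it). Rendering: `n = ν²` variables arranged as a
`ν × ν` matrix; size = wires (`productDepthEdgeClass`: every product gate has fan-in `≤ s`, so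
`deg f ≤ s^Δ` exactly as the printed proof uses behind `char F > s^Δ`, p0034:L6 — the hypothesis is
kept as printed); hitting is monotone in `r`, so "`r =`" is "`r ≥`" (`r` a natural number, `log₂`
inside `2^{(log s)^…}`); the universal `c` as printed; `Δ ≥ 1`; the threshold `s ≥ s₀` is made
explicit and chosen AFTER `Δ` (the proof goes through Lemma 6.6, asymptotic in `r` with a
`Δ`-dependent threshold).  (Correction of 2026-08-26: the first rendering had a `Δ`-uniform `s₀`
and the gates-only size.) [cite: AndrewsForbes2022, Lemma 6.7] -/
def AndrewsForbes2022_lemma_6_7 : Prop :=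
  ∃ c : ℝ, 0 < c ∧ ∀ Δ : ℕ, 1 ≤ Δ → ∃ s₀ : ℕ, ∀ (F : Type) [Field F] (ν s : ℕ), s₀ ≤ s →
    (ringChar F = 0 ∨ s ^ Δ < ringChar F) →
  ∀ r : ℕ, (2 : ℝ) ^ ((Real.logb 2 s) ^ (1 - Real.exp (-(c * Δ)))) ≤ r →
    IsHittingSetGenFor F
      (borderClass F (productDepthEdgeClass (LaurentSeries F) (Fin ν × Fin ν) s Δ))
      (matrixGenerator F ν ν (r - 1))

end LowDepth

/-! ### §7: Lemma 7.1 (conditional hitting sets for the closure of formulas) -/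

section Formulas

/-- **Andrews–Forbes 2022, Lemma 7.1** (first part; p0036:L15): `F` arbitrary; if `t : ℕ → ℕ` is
such that for every partition `σ` the border formula complexity of `(K_σ | K_σ)(X)` is at least
`t(σ₁)`, then `𝒢_{√n,√n,t⁻¹(2sn)-1}(Y,Z)` is a hitting set generator for the closure of `n`-variate
formulas of size `s`. Rendering: `n = ν²`; `t` monotone; the hypothesis is asked for `(K_σ | K_σ)`
on every `n' × m'` generic matrix and every shape with parts `≤ min(n',m')` (tree `kBideterminant`),
a stronger hypothesis than needed, hence a weaker fact.  SIZE CONVENTION AND THE CONSTANT: print's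
`r = t⁻¹(2sn)` is in the LEAF-count measure of formulas (its proof: a size-`s` formula for
`f + O(ε)` with the linear forms `ℓ_{i,j}(X, ε)` of Prop. 5.3 substituted into its leaves and scaled
by `1/(α ε^q)` is "a formula of size `sn`" computing `(K_σ | K_σ)(X) + O(ε)`, contradicting
`t(σ₁) ≥ t(r) ≥ 2sn`, p0036:L31–33); the tree's `formulaClass` / `borderFormulaComplexity` count
fan-in-two GATES, in which the same substitution costs at most `g + (g+1)(2ν² - 1) + 1 = 2ν²(g+1)`
gates for a `g`-gate formula (`≤ g + 1` leaves; each `ℓ_{i,j}` a fan-in-two formula with `ν²`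
leaves), so the printed contradiction reads `t(r) > 2ν²(s+1)` — hence the hypothesis
`2 (s+1) ν² < t(r)` (strict, `s + 1`): the printed statement read in the tree's measure
(`ν = 0`: `f` is a constant, hit trivially).  (Correction of 2026-08-26 after the val-lit referee
flag and ruling: the first rendering `2 s ν² ≤ t(r)` was false at `s = 0`, where a bare variable
`x_{1,1} ∈ I^det_1` has gate-count `0` and is missed by `𝒢_{ν,ν,0} = 0`.)  The homogeneous-formula
half is not typed (no homogeneous-formula size in the tree). [cite: AndrewsForbes2022, Lemma 7.1] -/
def AndrewsForbes2022_lemma_7_1 : Prop :=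
  ∀ (F : Type) [Field F] (t : ℕ → ℕ), Monotone t →
    (∀ (n' m' : ℕ) (σ : Multiset ℕ), σ ≠ 0 → (∀ p ∈ σ, 0 < p ∧ p ≤ min n' m') →
      t σ.sup ≤ borderFormulaComplexity F (kBideterminant F n' m' σ)) →
  ∀ (ν s r : ℕ), 1 ≤ r → 2 * (s + 1) * (ν * ν) < t r →
    IsHittingSetGenFor F (borderClass F (formulaClass (LaurentSeries F) (Fin ν × Fin ν) s))
      (matrixGenerator F ν ν (r - 1))

end Formulas

/-! ### §2.8 (Def. 2.40) and §8: IPS certificates, Lemma 8.1, Proposition 8.7 -/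

section IPS

variable (F : Type u) [Field F]

/-- **Def. 2.40** ([GP18]; p0018:L61): an Ideal Proof System certificate that the system
`f_i(x) = 0` (`i ∈ ι`) is unsatisfiable is a polynomial `C(x, y)` (placeholder variables `y_i`, one
per equation: index `σ ⊕ ι`) with `C(x, 0) = 0` and `C(x, f(x)) = 1`.
[cite: AndrewsForbes2022, Def. 2.40] -/
def IsIPSCertificate {σ : Type v} {ι : Type w} (f : ι → MvPolynomial σ F)
    (C : MvPolynomial (σ ⊕ ι) F) : Prop :=
  MvPolynomial.aeval (Sum.elim X fun _ : ι => (0 : MvPolynomial σ F)) C = 0 ∧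
    MvPolynomial.aeval (Sum.elim X f) C = 1

/-- **Andrews–Forbes 2022, Lemma 8.1** (generalising Lemma 2.41 [FSTW16]; p0039:L17): let
`f_1, …, f_m, g_1, …, g_k` be an unsatisfiable system with `g_1 = ⋯ = g_k = 0` satisfiable (by a point
of `F^σ`, as in the proof), and `C(x, y, z)` an IPS refutation of it; then `1 - C(x, 0, g(x))` is a
nonzero element of the ideal `⟨f_1, …, f_m⟩ ⊆ F[x]`. (Unsatisfiability is implied by the existence
of `C` and not repeated.) [cite: AndrewsForbes2022, Lemma 8.1 (and Lemma 2.41)] -/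
def AndrewsForbes2022_lemma_8_1 : Prop :=
  ∀ (F : Type) [Field F] (σ ι κ : Type) (f : ι → MvPolynomial σ F) (g : κ → MvPolynomial σ F)
    (C : MvPolynomial (σ ⊕ (ι ⊕ κ)) F), IsIPSCertificate F (Sum.elim f g) C →
    (∃ a : σ → F, ∀ j, MvPolynomial.eval a (g j) = 0) →
    1 - MvPolynomial.aeval (Sum.elim X (Sum.elim (fun _ : ι => (0 : MvPolynomial σ F)) g)) C ≠ 0 ∧
      1 - MvPolynomial.aeval (Sum.elim X (Sum.elim (fun _ : ι => (0 : MvPolynomial σ F)) g)) C ∈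
        Ideal.span (Set.range f)

/-- Variables of the hard instance of §8: the entries of the two `n × n` matrices `X` (left) and
`Y` (right). [cite: AndrewsForbes2022, §8 (Prop. 8.7)] -/
abbrev DetInvVars (n : ℕ) : Type := (Fin n × Fin n) ⊕ (Fin n × Fin n)

/-- Equations of the system `𝓕 = {det_n(X) = 0, XY - I_n = 0}`: one for the determinant (`inl ()`)
and one per entry of `XY - I_n` (`inr (i,j)`). [cite: AndrewsForbes2022, Prop. 8.7] -/
abbrev DetInvEqns (n : ℕ) : Type := Unit ⊕ (Fin n × Fin n)

/-- The matrix `X` of variables. [cite: AndrewsForbes2022, §8 (Prop. 8.7)] -/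
def detInvX (n : ℕ) : Matrix (Fin n) (Fin n) (MvPolynomial (DetInvVars n) F) :=
  Matrix.of fun i j => X (Sum.inl (i, j))

/-- The matrix `Y` of variables. [cite: AndrewsForbes2022, §8 (Prop. 8.7)] -/
def detInvY (n : ℕ) : Matrix (Fin n) (Fin n) (MvPolynomial (DetInvVars n) F) :=
  Matrix.of fun i j => X (Sum.inr (i, j))

/-- **The system `𝓕 = {det(X) = 0, XY - I_n = 0}`** of Prop. 8.7 (p0041:L25; §1.4.5 p0009:L14:
"`det_n(X) = 0` implies that `X` is non-invertible, while `XY - I_n = 0` implies that `X` is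
invertible"). [cite: AndrewsForbes2022, Prop. 8.7] -/
def detInvSystem (n : ℕ) : DetInvEqns n → MvPolynomial (DetInvVars n) F
  | Sum.inl _ => (detInvX F n).det
  | Sum.inr ij => (detInvX F n * detInvY F n - 1) ij.1 ij.2

/-- **The refutation `C(X, Y, w, Z) = 1 - det_n(Z + I_n) + w · det_n(Y)`** of Prop. 8.7 (p0041:L33;
`w` the placeholder of `det X`, `Z` the placeholders of `XY - I_n`) — "a depth-three `det_n`-oracle
circuit with `O(n²)` wires": two `det_n`-oracle gates fed by the affine forms `Z + I_n` and `Y`, one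
product with `w`, one top addition gate. [cite: AndrewsForbes2022, Prop. 8.7 (proof)] -/
def detInvCertificate (n : ℕ) : MvPolynomial (DetInvVars n ⊕ DetInvEqns n) F :=
  1 - (Matrix.of (fun i j : Fin n => X (Sum.inr (Sum.inr (i, j)))) + 1).det +
    X (Sum.inr (Sum.inl ())) * (Matrix.of fun i j : Fin n => X (Sum.inl (Sum.inr (i, j)))).det

variable {F}

/-- **Andrews–Forbes 2022, Proposition 8.7** (any field; p0041:L25–L55): `C = 1 - det_n(Z + I_n) +
w det_n(Y)` is an IPS refutation of `{det(X) = 0, XY - I_n = 0}`: `C(X,Y,0,0) = 1 - det(I_n) = 0` and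
`C(X, Y, det X, XY - I_n) = 1 - det(XY) + det X · det Y = 1`. (Bullet (2), the approximate-oracle
version, is bullet (1) with Lemma 2.3.) [cite: AndrewsForbes2022, Prop. 8.7] -/
theorem AndrewsForbes2022_prop_8_7 (n : ℕ) :
    IsIPSCertificate F (detInvSystem F n) (detInvCertificate F n) := by
  constructor
  · -- `C(X, Y, 0, 0) = 1 - det(0 + I) + 0 = 0`
    have h1 : (MvPolynomial.aeval (R := F)
        (Sum.elim X fun _ : DetInvEqns n => (0 : MvPolynomial (DetInvVars n) F))).mapMatrix
        (Matrix.of (fun i j : Fin n => X (Sum.inr (Sum.inr (i, j)))) + 1) = 1 := by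
      ext i j
      simp [Matrix.one_apply]
    simp only [detInvCertificate, map_add, map_sub, map_one, map_mul, AlgHom.map_det, h1,
      Matrix.det_one, MvPolynomial.aeval_X, Sum.elim_inr, zero_mul, add_zero, sub_self]
  · -- `C(X, Y, det X, XY - I) = 1 - det(XY) + det X det Y = 1`
    have h1 : (MvPolynomial.aeval (R := F) (Sum.elim X (detInvSystem F n))).mapMatrix
        (Matrix.of (fun i j : Fin n => X (Sum.inr (Sum.inr (i, j)))) + 1) =
          detInvX F n * detInvY F n := by
      ext i j
      simp [Matrix.one_apply, detInvSystem, Matrix.sub_apply]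
    have h2 : (MvPolynomial.aeval (R := F) (Sum.elim X (detInvSystem F n))).mapMatrix
        (Matrix.of fun i j : Fin n => X (Sum.inl (Sum.inr (i, j)))) = detInvY F n := by
      ext i j
      simp [detInvY]
    simp only [detInvCertificate, map_add, map_sub, map_one, map_mul, AlgHom.map_det, h1, h2,
      MvPolynomial.aeval_X, Sum.elim_inr, Matrix.det_mul]
    simp [detInvSystem]

end IPS

/-! ### Proof of Lemma 8.1: `AndrewsForbes2022_lemma_8_1_holds` -/

section Lemma81Proof

/-- **Discharge of `AndrewsForbes2022_lemma_8_1`**, following the printed proof (p0039:L21–L47):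
nonvanishing by evaluating at a point `α` with `g(α) = 0` (there `h(α) = 1 - C(α, 0, 0) = 1`), and
ideal membership because `h = C(x, f, g) - C(x, 0, g)` and the two substitutions agree modulo
`⟨f_1, …, f_m⟩` (the printed expansion in powers of `y`, done here in the quotient ring).
[cite: AndrewsForbes2022, Lemma 8.1] -/
theorem AndrewsForbes2022_lemma_8_1_holds : AndrewsForbes2022_lemma_8_1 := by
  intro F _ σ ι κ f g C hC hsat
  obtain ⟨h0, h1⟩ := hC
  set b : σ ⊕ (ι ⊕ κ) → MvPolynomial σ F :=
    Sum.elim X (Sum.elim (fun _ : ι => (0 : MvPolynomial σ F)) g) with hb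
  constructor
  · -- nonzero: evaluate at `α`
    obtain ⟨α, hα⟩ := hsat
    intro hzero
    have hfun : (fun i => MvPolynomial.aeval α (b i)) =
        fun i => MvPolynomial.aeval α ((Sum.elim X fun _ : ι ⊕ κ => (0 : MvPolynomial σ F)) i) := by
      funext x
      rcases x with x | i | j
      · rfl
      · simp [hb]
      · simp only [hb, Sum.elim_inr, map_zero]
        exact hα j
    have hev : MvPolynomial.aeval α (MvPolynomial.aeval b C) =
        MvPolynomial.aeval α (MvPolynomial.aeval
          (Sum.elim X fun _ : ι ⊕ κ => (0 : MvPolynomial σ F)) C) := by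
      rw [comp_aeval_apply, comp_aeval_apply, hfun]
    have h2 : MvPolynomial.aeval α (1 - MvPolynomial.aeval b C) = 1 := by
      rw [map_sub, map_one, hev, h0, map_zero, sub_zero]
    rw [hzero, map_zero] at h2
    exact zero_ne_one h2
  · -- membership: pass to the quotient by `⟨f⟩`
    set I : Ideal (MvPolynomial σ F) := Ideal.span (Set.range f) with hI
    have hfun : (fun i => Ideal.Quotient.mkₐ F I ((Sum.elim X (Sum.elim f g)) i)) =
        fun i => Ideal.Quotient.mkₐ F I (b i) := by
      funext x
      rcases x with x | i | j
      · rfl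
      · simp only [Sum.elim_inr, Sum.elim_inl, hb, map_zero, Ideal.Quotient.mkₐ_eq_mk]
        exact Ideal.Quotient.eq_zero_iff_mem.mpr (Ideal.subset_span ⟨i, rfl⟩)
      · rfl
    have hq : Ideal.Quotient.mkₐ F I (MvPolynomial.aeval (Sum.elim X (Sum.elim f g)) C) =
        Ideal.Quotient.mkₐ F I (MvPolynomial.aeval b C) := by
      rw [comp_aeval_apply, comp_aeval_apply, hfun]
    rw [h1, map_one] at hq
    have hmem : (1 : MvPolynomial σ F) - MvPolynomial.aeval b C ∈ I := by
      rw [← Ideal.Quotient.mk_eq_mk_iff_sub_mem]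
      simpa [Ideal.Quotient.mkₐ_eq_mk] using hq
    exact hmem

end Lemma81Proof

/-! ### Lemma 2.10, the inclusion `I^det_{n,m,r+1} ⊆ ker (X ↦ YZ)` (proved) -/

section Lemma210Easy

/-- A product of an `(r+1) × r` and an `r × (r+1)` matrix has determinant `0` (rank `≤ r`): pad
both to squares by a zero column, resp. a zero row. [folklore] -/
private theorem det_mul_rect_eq_zero {R : Type u} [CommRing R] (r : ℕ)
    (A : Matrix (Fin (r + 1)) (Fin r) R) (B : Matrix (Fin r) (Fin (r + 1)) R) : (A * B).det = 0 := by
  let A' : Matrix (Fin (r + 1)) (Fin (r + 1)) R :=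
    Matrix.of fun i k => Fin.lastCases (0 : R) (fun k' => A i k') k
  let B' : Matrix (Fin (r + 1)) (Fin (r + 1)) R :=
    Matrix.of fun k j => Fin.lastCases (0 : R) (fun k' => B k' j) k
  have hAB : A * B = A' * B' := by
    ext i j
    simp only [Matrix.mul_apply, Matrix.of_apply, A', B']
    rw [Fin.sum_univ_castSucc]
    simp [Fin.lastCases_castSucc, Fin.lastCases_last]
  rw [hAB, Matrix.det_mul]
  have hA : A'.det = 0 :=
    Matrix.det_eq_zero_of_column_eq_zero (Fin.last r) fun i => by simp [A', Fin.lastCases_last]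
  rw [hA, zero_mul]

/-- **Lemma 2.10, direction `⇐`** (PROVED; the "clear" inclusion `I^det_{n,m,r+1} ⊆ J_{n,m,r}`,
p0013:L58): every element of the ideal of the `(r+1) × (r+1)` minors vanishes on `𝒢_{n,m,r}(Y,Z) = YZ`
— an `(r+1) × (r+1)` minor of `YZ` is `det` of a product through `F^r`. The converse direction is the
content of the named fact `AndrewsForbes2022_lemma_2_10`. [cite: AndrewsForbes2022, Lemma 2.10] -/
theorem bind₁_matrixGenerator_eq_zero_of_mem_detIdeal {F : Type u} [Field F] {n m r : ℕ}
    {f : MvPolynomial (Fin n × Fin m) F} (hf : f ∈ detIdeal F n m (r + 1)) :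
    MvPolynomial.bind₁ (matrixGenerator F n m r) f = 0 := by
  -- `Y`, `Z` and `YZ`
  let Y : Matrix (Fin n) (Fin r) (MvPolynomial (MatGenSeed n m r) F) :=
    Matrix.of fun i k => X (Sum.inl (i, k))
  let Z : Matrix (Fin r) (Fin m) (MvPolynomial (MatGenSeed n m r) F) :=
    Matrix.of fun k j => X (Sum.inr (k, j))
  have hG : ∀ ij : Fin n × Fin m, matrixGenerator F n m r ij = (Y * Z) ij.1 ij.2 := by
    intro ij
    simp [matrixGenerator, Matrix.mul_apply, Y, Z]
  -- the generators go to `0`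
  have key : detIdeal F n m (r + 1) ≤
      RingHom.ker (MvPolynomial.bind₁ (matrixGenerator F n m r)).toRingHom := by
    refine Ideal.span_le.mpr ?_
    rintro p ⟨ρ, γ, rfl⟩
    rw [SetLike.mem_coe, RingHom.mem_ker, AlgHom.toRingHom_eq_coe, RingHom.coe_coe,
      AlgHom.map_det]
    have hmat : (MvPolynomial.bind₁ (matrixGenerator F n m r)).mapMatrix
        ((mvPolynomialX (Fin n) (Fin m) F).submatrix ρ γ) =
          Y.submatrix ρ id * Z.submatrix id γ := by
      rw [← Matrix.submatrix_mul _ _ ρ id γ Function.bijective_id]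
      refine Matrix.ext fun a b => ?_
      simp only [AlgHom.mapMatrix_apply, Matrix.map_apply, Matrix.submatrix_apply, mvPolynomialX,
        Matrix.of_apply, bind₁_X_right]
      exact hG (ρ a, γ b)
    rw [hmat]
    exact det_mul_rect_eq_zero r _ _
  exact key hf

end Lemma210Easy

end Literature.Computability.AlgebraicComplexity
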